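import Mathlib
import HarnessLib
import Literature.NumberTheory.LFunctions.RobertSargosWeylDifferencing
import Literature.NumberTheory.LFunctions.RobertSargosThirdDerivPerturb
import Literature.NumberTheory.LFunctions.RobertSargosTaylorBox
import Literature.NumberTheory.LFunctions.RobertSargosLemma4

/-!
# Robert–Sargos 2002, Steps 1–3 of the proof of Theorem 1 — PROVED

Topic `Literature/NumberTheory/LFunctions`. Everything in this file is PROVED (no `sorry`, no named
facts). It formalizes Steps 1, 2 and 3 of §4 of O. Robert, P. Sargos, *A fourth derivative test for
exponential sums*, Compositio Math. 130 (2002), 275–292 (= arXiv:2307.03562v1), for a derivative family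
`D` of order `4` on `[0, L]` with `λ ≤ D 4 ≤ Λ` (`f = D 0`; the general interval `[a, b]` is reduced to
`[0, L]` by translation in the assembly):

* **Step 1** (`Thm1.step1`): the symmetric Weyl–van der Corput inequality (4·3)
  (`RobertSargos.vanDerCorput_symmetric_e`) and the dyadic pigeon-hole replacing (4·4)
  (`RobertSargos.exists_dyadic_block`) give, for `2 ≤ H ≤ L`, a dyadic `H₁ < H` with
  `|∑_{0<n≤L} e(f(n))|² ≤ 3L²/H + (6L/H)(log₂ H + 1) S(H₁)`,
  `S(H₁) = ∑_{H₁≤h<2H₁} |∑_{h<m≤L-h} e(Δ_h f(m))|`, `Δ_h f(x) = f(x+h) - f(x-h)` ((4·5)–(4·6));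
  for small `H₁` the third derivative test bounds `S(H₁)` directly (`Thm1.small_block_bound`, the
  printed use of Lemma 3 in Step 1).
* **Step 2** (`Thm1.step23`, first half): Lemma 1 (`RobertSargos.aProcess_AA`, applied to
  `a(m, h) = c_h e(Δ_h f(m))` with unimodular `c_h` turning `|a_h|` into `c_h a_h`) and the bounds for
  the terms with `r = 0`, `q ≠ 0` (second derivative test, `Thm1.qterm_bound`: the second derivative
  of `Δ_h f(x+q) - Δ_h f(x)` is `≍ 2h|q|λ`) and with `q = 0`, `r ≠ 0` (`Thm1.rterm_bound`: the third
  derivative of `Δ_h f(x) - Δ_{h+r} f(x)` is `-(f'''(x+h+r) - f'''(x+h)) - (f'''(x-h) - f'''(x-h-r))`, of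
  size `2|r|λ` and constant sign, so the signed third derivative test
  `RobertSargos.thirdDerivTest_signed` applies — the printed proof obtains the same bound from its
  Lemma 3 with `g = -2r f'`, `u' ≪ H³λ`).
* **Step 3** (`Thm1.step23`, second half): the averaging identity (4·11) (`Thm1.shift_avg`) with the
  fixed window `J₀ = (Y₀, L - Y₀ - N]`, `Y₀ = Q + N + 3H₁ + R + 7` (`Thm1.shift_avg_approx`), giving
  (4·12) with all degenerate terms explicit:
  `S(H₁)² ≤ (4LH₁/(QR)) [LH₁ + ∑_{q≠0,h} 12(C₀L(2h|q|λ)^{1/2} + (2h|q|λ)^{-1/2})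
    + ∑_{r≠0} (96 C₀ H₁ (L(2|r|λ)^{1/6} + L^{1/2}(2|r|λ)^{-1/6}) + 2QH₁(2Y₀+N)
    + (1/N) ∑_{m∈J₀} |∑_{0<|q|<Q} ∑_{H₁≤h<2H₁} ∑_{n=1}^{N} (1-|q|/Q) θ_r(h) e(Δ_h f(m+n+q) - Δ_{h+r} f(m+n))|)]`
  with `|θ_r(h)| ≤ 1` (`C₀ = Λ/λ`). The window margin `Y₀` is chosen so that Step 4
  (`RobertSargos.step4_partialSummation`) applies to every `m ∈ J₀`.
* Reindexing tools for the assembly: `Thm1.sum_qhn_reindex` (the `(q, h, n)` box as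
  `q = ±(q'+1)`, `h = H₁ + h'`, `n = n' + 1`), `Thm1.block_sum_nat_int`.

All statements live in the namespace `Literature.NumberTheory.LFunctions.RobertSargos.Thm1`.

## References

* O. Robert, P. Sargos, *A fourth derivative test for exponential sums*, Compositio Math. 130 (2002),
  275–292, doi:10.1023/A:1014363224308 = arXiv:2307.03562v1 — §4, Steps 1–3, (4·3)–(4·12).
  [RobertSargos2002]
* S. W. Graham, G. Kolesnik, *Van der Corput's Method of Exponential Sums*, CUP 1991, Lemma 6.1,
  Thm 2.2 (the tree's `aProcess_AA`, `VdC.secondDerivTest`). [GrahamKolesnik1991]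
-/

noncomputable section

open Finset Set

namespace Literature.NumberTheory.LFunctions
namespace RobertSargos

open Literature.NumberTheory.LFunctions.VdC (e norm_e e_add e_sub e_neg e_int DerivFamily thirdDerivTest
  secondDerivTest sum_Ioc_shift)
open scoped ComplexConjugate

namespace Thm1

/-! ### Shifted combinations of a derivative family -/

/-- `x ↦ D j (x + s)` is a derivative family on `[lo, hi]` when `[lo + s, hi + s] ⊆ [a, b]`.
[folklore] -/
theorem hasDerivAt_shift {D : ℕ → ℝ → ℝ} {a b : ℝ} {k : ℕ} (hD : DerivFamily D a b k) (s : ℝ)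
    {j : ℕ} (hj : j < k) {x : ℝ} (h₁ : a ≤ x + s) (h₂ : x + s ≤ b) :
    HasDerivAt (fun x => D j (x + s)) (D (j + 1) (x + s)) x :=
  (hD j hj (x + s) ⟨h₁, h₂⟩).comp_add_const x s

/-- The four-term combination `x ↦ D j (x + s₁) - D j (x + s₂) - (D j (x + s₃) - D j (x + s₄))` of a
derivative family is a derivative family on `[lo, hi]` when all `[lo + sᵢ, hi + sᵢ] ⊆ [a, b]`.
[folklore] -/
theorem derivFamily_comb4 {D : ℕ → ℝ → ℝ} {a b : ℝ} {k : ℕ} (hD : DerivFamily D a b k)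
    (s₁ s₂ s₃ s₄ : ℝ) {lo hi : ℝ}
    (h₁ : a ≤ lo + s₁) (h₁' : hi + s₁ ≤ b) (h₂ : a ≤ lo + s₂) (h₂' : hi + s₂ ≤ b)
    (h₃ : a ≤ lo + s₃) (h₃' : hi + s₃ ≤ b) (h₄ : a ≤ lo + s₄) (h₄' : hi + s₄ ≤ b) :
    DerivFamily (fun j x => D j (x + s₁) - D j (x + s₂) - (D j (x + s₃) - D j (x + s₄))) lo hi k := by
  intro j hj x hx
  have g : ∀ s : ℝ, a ≤ lo + s → hi + s ≤ b →
      HasDerivAt (fun x => D j (x + s)) (D (j + 1) (x + s)) x :=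
    fun s hs hs' => hasDerivAt_shift hD s hj (by linarith [hx.1]) (by linarith [hx.2])
  exact ((g s₁ h₁ h₁').sub (g s₂ h₂ h₂')).sub ((g s₃ h₃ h₃').sub (g s₄ h₄ h₄'))

/-- The two-term combination `x ↦ D j (x + s₁) - D j (x + s₂)`. [folklore] -/
theorem derivFamily_comb2 {D : ℕ → ℝ → ℝ} {a b : ℝ} {k : ℕ} (hD : DerivFamily D a b k)
    (s₁ s₂ : ℝ) {lo hi : ℝ} (h₁ : a ≤ lo + s₁) (h₁' : hi + s₁ ≤ b) (h₂ : a ≤ lo + s₂) (h₂' : hi + s₂ ≤ b) :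
    DerivFamily (fun j x => D j (x + s₁) - D j (x + s₂)) lo hi k := by
  intro j hj x hx
  exact (hasDerivAt_shift hD s₁ hj (by linarith [hx.1]) (by linarith [hx.2])).sub
    (hasDerivAt_shift hD s₂ hj (by linarith [hx.1]) (by linarith [hx.2]))

/-! ### Sizes of the differenced derivatives -/

/-- Step 1: `(Δ_d f)''' = f'''(x+d) - f'''(x-d) ∈ [2dλ, 2dΛ]` for `d ≥ 0`. [cite: RobertSargos2002, Step 1] -/
theorem symm_D3_bounds {D : ℕ → ℝ → ℝ} {a b lam Λ : ℝ} (hD : DerivFamily D a b 4)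
    (hb : ∀ t ∈ Set.Icc a b, lam ≤ D 4 t ∧ D 4 t ≤ Λ) {d x : ℝ} (hd : 0 ≤ d) (h₁ : a ≤ x - d) (h₂ : x + d ≤ b) :
    2 * d * lam ≤ D 3 (x + d) - D 3 (x + -d) ∧ D 3 (x + d) - D 3 (x + -d) ≤ 2 * d * Λ := by
  have := D3_incr hD hb (x := x - d) (y := x + d) h₁ (by linarith) h₂
  rw [show x + -d = x - d by ring]
  constructor <;> nlinarith [this.1, this.2]

/-- Step 2, `r = 0`: the second derivative of `Δ_h f(x+q) - Δ_h f(x)` is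
`(f''(x+q+h) - f''(x+h)) - (f''(x+q-h) - f''(x-h)) ∈ [2qhλ, 2qhΛ]` for `q, h ≥ 0`.
[cite: RobertSargos2002, Step 2] -/
theorem qdiff_D2_bounds {D : ℕ → ℝ → ℝ} {a b lam Λ : ℝ} (hD : DerivFamily D a b 4)
    (hb : ∀ t ∈ Set.Icc a b, lam ≤ D 4 t ∧ D 4 t ≤ Λ) {q h x : ℝ} (hq : 0 ≤ q) (hh : 0 ≤ h)
    (h₁ : a ≤ x - h) (h₂ : x + q + h ≤ b) :
    2 * q * h * lam ≤ D 2 (x + (q + h)) - D 2 (x + (q - h)) - (D 2 (x + h) - D 2 (x + -h)) ∧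
      D 2 (x + (q + h)) - D 2 (x + (q - h)) - (D 2 (x + h) - D 2 (x + -h)) ≤ 2 * q * h * Λ := by
  have := twoD2_incr hD hb (k := q) (x := x - h) (y := x + h) hq h₁ (by linarith) (by linarith)
  have e1 : x + (q + h) = x + h + q := by ring
  have e2 : x + (q - h) = x - h + q := by ring
  have e3 : x + -h = x - h := by ring
  rw [e1, e2, e3]
  constructor <;> nlinarith [this.1, this.2]

/-- Step 2, `q = 0`: the third derivative of `Δ_h f(x) - Δ_{h+r} f(x)` is
`-(f'''(x+h+r) - f'''(x+h)) - (f'''(x-h) - f'''(x-h-r)) ∈ [-2rΛ, -2rλ]` for `r ≥ 0`.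
[cite: RobertSargos2002, Step 2] -/
theorem rdiff_D3_bounds_pos {D : ℕ → ℝ → ℝ} {a b lam Λ : ℝ} (hD : DerivFamily D a b 4)
    (hb : ∀ t ∈ Set.Icc a b, lam ≤ D 4 t ∧ D 4 t ≤ Λ) {r h x : ℝ} (hr : 0 ≤ r)
    (h₁ : a ≤ x - h - r) (h₁' : x - h ≤ b) (h₂ : a ≤ x + h) (h₂' : x + h + r ≤ b) :
    2 * r * lam ≤ -(D 3 (x + h) - D 3 (x + -h) - (D 3 (x + (h + r)) - D 3 (x + (-h - r)))) ∧
      -(D 3 (x + h) - D 3 (x + -h) - (D 3 (x + (h + r)) - D 3 (x + (-h - r)))) ≤ 2 * r * Λ := by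
  have i1 := D3_incr hD hb (x := x + h) (y := x + h + r) h₂ (by linarith) h₂'
  have i2 := D3_incr hD hb (x := x - h - r) (y := x - h) h₁ (by linarith) h₁'
  have e1 : x + (h + r) = x + h + r := by ring
  have e2 : x + (-h - r) = x - h - r := by ring
  have e3 : x + -h = x - h := by ring
  rw [e1, e2, e3]
  constructor <;> nlinarith [i1.1, i1.2, i2.1, i2.2]

/-- Step 2, `q = 0`, `r ≤ 0`: the third derivative of `Δ_h f(x) - Δ_{h+r} f(x)` lies in
`[2|r|λ, 2|r|Λ]`. [cite: RobertSargos2002, Step 2] -/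
theorem rdiff_D3_bounds_neg {D : ℕ → ℝ → ℝ} {a b lam Λ : ℝ} (hD : DerivFamily D a b 4)
    (hb : ∀ t ∈ Set.Icc a b, lam ≤ D 4 t ∧ D 4 t ≤ Λ) {r h x : ℝ} (hr : r ≤ 0)
    (h₁ : a ≤ x - h) (h₁' : x - h - r ≤ b) (h₂ : a ≤ x + h + r) (h₂' : x + h ≤ b) :
    2 * (-r) * lam ≤ D 3 (x + h) - D 3 (x + -h) - (D 3 (x + (h + r)) - D 3 (x + (-h - r))) ∧
      D 3 (x + h) - D 3 (x + -h) - (D 3 (x + (h + r)) - D 3 (x + (-h - r))) ≤ 2 * (-r) * Λ := by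
  have i1 := D3_incr hD hb (x := x + h + r) (y := x + h) h₂ (by linarith) h₂'
  have i2 := D3_incr hD hb (x := x - h) (y := x - h - r) h₁ (by linarith) h₁'
  have e1 : x + (h + r) = x + h + r := by ring
  have e2 : x + (-h - r) = x - h - r := by ring
  have e3 : x + -h = x - h := by ring
  rw [e1, e2, e3]
  constructor <;> nlinarith [i1.1, i1.2, i2.1, i2.2]

/-! ### Integer intervals -/

/-- The averaging identity of Step 3: `∑_{lo<m≤hi} F(m) = (1/N) ∑_{n=1}^{N} ∑_{lo-n<m≤hi-n} F(m+n)`.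
[cite: RobertSargos2002, Step 3, (4.11)] -/
theorem shift_avg (F : ℤ → ℂ) (lo hi : ℤ) {N : ℕ} (hN : 1 ≤ N) :
    ∑ m ∈ Finset.Ioc lo hi, F m =
      (1 / (N : ℂ)) * ∑ n ∈ Finset.Icc (1 : ℤ) N, ∑ m ∈ Finset.Ioc (lo - n) (hi - n), F (m + n) := by
  have hin : ∀ n ∈ Finset.Icc (1 : ℤ) N, ∑ m ∈ Finset.Ioc (lo - n) (hi - n), F (m + n) = ∑ m ∈ Finset.Ioc lo hi, F m := by
    intro n _
    rw [sum_Ioc_shift F (lo - n) (hi - n) n]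
    simp
  rw [Finset.sum_congr rfl hin, Finset.sum_const, Int.card_Icc, nsmul_eq_mul]
  have hN' : ((N : ℤ) + 1 - 1).toNat = N := by simp
  rw [hN']
  have hN0 : (N : ℂ) ≠ 0 := by exact_mod_cast (by omega : N ≠ 0)
  field_simp

/-- Step 3 with a fixed window: if `J₀ = (c₀, d₀]` with `lo - 1 ≤ c₀` and `d₀ + N ≤ hi`, and
`#(lo, hi] ≤ #J₀ + E`, then for `|F| ≤ 1`,
`|∑_{lo<m≤hi} F(m) - (1/N) ∑_{n=1}^{N} ∑_{m ∈ J₀} F(m+n)| ≤ E`. [cite: RobertSargos2002, Step 3] -/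
theorem shift_avg_approx (F : ℤ → ℂ) (hF : ∀ m, ‖F m‖ ≤ 1) {lo hi c₀ d₀ : ℤ} {N : ℕ} (hN : 1 ≤ N)
    (hc : lo - 1 ≤ c₀) (hd : d₀ + N ≤ hi) {E : ℝ}
    (hE : ((hi - lo).toNat : ℝ) ≤ ((d₀ - c₀).toNat : ℝ) + E) :
    ‖∑ m ∈ Finset.Ioc lo hi, F m - (1 / (N : ℂ)) * ∑ n ∈ Finset.Icc (1 : ℤ) N, ∑ m ∈ Finset.Ioc c₀ d₀, F (m + n)‖ ≤ E := by
  rw [shift_avg F lo hi hN, ← mul_sub, ← Finset.sum_sub_distrib]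
  have hsub : ∀ n ∈ Finset.Icc (1 : ℤ) N, Finset.Ioc c₀ d₀ ⊆ Finset.Ioc (lo - n) (hi - n) := by
    intro n hn m hm
    rw [Finset.mem_Icc] at hn
    rw [Finset.mem_Ioc] at hm ⊢
    constructor <;> omega
  have hin : ∀ n ∈ Finset.Icc (1 : ℤ) N,
      ‖∑ m ∈ Finset.Ioc (lo - n) (hi - n), F (m + n) - ∑ m ∈ Finset.Ioc c₀ d₀, F (m + n)‖ ≤ E := by
    intro n hn
    rw [← Finset.sum_sdiff (hsub n hn), add_sub_cancel_right]
    calc ‖∑ m ∈ Finset.Ioc (lo - n) (hi - n) \ Finset.Ioc c₀ d₀, F (m + n)‖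
        ≤ ∑ m ∈ Finset.Ioc (lo - n) (hi - n) \ Finset.Ioc c₀ d₀, ‖F (m + n)‖ := norm_sum_le _ _
      _ ≤ ∑ m ∈ Finset.Ioc (lo - n) (hi - n) \ Finset.Ioc c₀ d₀, (1 : ℝ) := Finset.sum_le_sum fun m _ => hF _
      _ = ((Finset.Ioc (lo - n) (hi - n) \ Finset.Ioc c₀ d₀).card : ℝ) := by simp
      _ ≤ E := by
          rw [Finset.card_sdiff_of_subset (hsub n hn), Int.card_Ioc, Int.card_Ioc]
          have e1 : hi - n - (lo - n) = hi - lo := by ring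
          rw [e1]
          have hle : (d₀ - c₀).toNat ≤ (hi - lo).toNat := by
            have := Finset.card_le_card (hsub n hn)
            rwa [Int.card_Ioc, Int.card_Ioc, e1] at this
          rw [Nat.cast_sub hle]
          linarith
  have hN0 : (0 : ℝ) < N := by exact_mod_cast hN
  calc ‖(1 / (N : ℂ)) * ∑ n ∈ Finset.Icc (1 : ℤ) N,
        (∑ m ∈ Finset.Ioc (lo - n) (hi - n), F (m + n) - ∑ m ∈ Finset.Ioc c₀ d₀, F (m + n))‖
      ≤ (1 / N) * ∑ n ∈ Finset.Icc (1 : ℤ) N,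
        ‖∑ m ∈ Finset.Ioc (lo - n) (hi - n), F (m + n) - ∑ m ∈ Finset.Ioc c₀ d₀, F (m + n)‖ := by
        rw [norm_mul]
        have : ‖(1 / (N : ℂ))‖ = 1 / N := by simp
        rw [this]
        exact mul_le_mul_of_nonneg_left (norm_sum_le _ _) (by positivity)
    _ ≤ (1 / N) * ∑ n ∈ Finset.Icc (1 : ℤ) N, E :=
        mul_le_mul_of_nonneg_left (Finset.sum_le_sum hin) (by positivity)
    _ = E := by
        rw [Finset.sum_const, Int.card_Icc, nsmul_eq_mul]
        have hN' : ((N : ℤ) + 1 - 1).toNat = N := by simp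
        rw [hN']
        field_simp

/-- Unimodular multipliers: for every `g` there are `c_h`, `|c_h| ≤ 1`, with `c_h g(h) = |g(h)|`.
[folklore] -/
theorem exists_unit_coeffs (g : ℤ → ℂ) : ∃ c : ℤ → ℂ, (∀ h, ‖c h‖ ≤ 1) ∧ ∀ h, c h * g h = (‖g h‖ : ℂ) := by
  choose c hc using fun h => exists_unit_mul_eq_norm (g h)
  exact ⟨c, fun h => (hc h).1, fun h => (hc h).2⟩

/-- Reindexing the `q`-sum: `∑_{0<|q|<Q} G(q) = ∑_{q'<Q-1} G(q'+1) + ∑_{q'<Q-1} G(-(q'+1))`.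
[folklore] -/
theorem sum_erase_zero_eq {M : Type*} [AddCommMonoid M] (G : ℤ → M) (Q : ℕ) :
    ∑ q ∈ (Finset.Ioo (-(Q : ℤ)) Q).erase 0, G q =
      ∑ q' ∈ range (Q - 1), G ((q' : ℤ) + 1) + ∑ q' ∈ range (Q - 1), G (-((q' : ℤ) + 1)) := by
  classical
  have hsplit := (Finset.sum_filter_add_sum_filter_not ((Finset.Ioo (-(Q : ℤ)) Q).erase 0) (fun q => 0 < q) G).symm
  rw [hsplit]
  congr 1
  · have hS : ((Finset.Ioo (-(Q : ℤ)) Q).erase 0).filter (fun q => 0 < q) =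
        (range (Q - 1)).image (fun q' : ℕ => (q' : ℤ) + 1) := by
      ext q
      simp only [Finset.mem_filter, Finset.mem_erase, Finset.mem_Ioo, Finset.mem_image, Finset.mem_range]
      constructor
      · rintro ⟨⟨hq0, hq1, hq2⟩, hq3⟩
        exact ⟨(q - 1).toNat, by omega, by omega⟩
      · rintro ⟨q', hq', rfl⟩; omega
    rw [hS, Finset.sum_image]
    intro x _ y _ h; simpa using h
  · have hS : ((Finset.Ioo (-(Q : ℤ)) Q).erase 0).filter (fun q => ¬ 0 < q) =
        (range (Q - 1)).image (fun q' : ℕ => -((q' : ℤ) + 1)) := by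
      ext q
      simp only [Finset.mem_filter, Finset.mem_erase, Finset.mem_Ioo, Finset.mem_image, Finset.mem_range]
      constructor
      · rintro ⟨⟨hq0, hq1, hq2⟩, hq3⟩
        exact ⟨(-q - 1).toNat, by omega, by omega⟩
      · rintro ⟨q', hq', rfl⟩; omega
    rw [hS, Finset.sum_image]
    intro x _ y _ h
    have : (x : ℤ) + 1 = (y : ℤ) + 1 := neg_injective h
    exact_mod_cast (by omega : (x : ℤ) = y)

/-- Reindexing the `h`-sum: `∑_{H₁ ≤ h < 2H₁} G(h) = ∑_{h' < H₁} G(H₁ + h')`. [folklore] -/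
theorem sum_Ico_dyadic_eq {M : Type*} [AddCommMonoid M] (G : ℤ → M) (H₁ : ℕ) :
    ∑ h ∈ Finset.Ico (H₁ : ℤ) (2 * H₁), G h = ∑ h' ∈ range H₁, G ((H₁ : ℤ) + h') := by
  rw [Int.Ico_eq_finset_map, Finset.sum_map]
  have : (2 * (H₁ : ℤ) - H₁).toNat = H₁ := by
    rw [show 2 * (H₁ : ℤ) - H₁ = H₁ by ring]; simp
  rw [this]
  rfl

/-- Reindexing the `n`-sum: `∑_{1 ≤ n ≤ N} G(n) = ∑_{n' < N} G(n'+1)`. [folklore] -/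
theorem sum_Icc_one_eq {M : Type*} [AddCommMonoid M] (G : ℤ → M) (N : ℕ) :
    ∑ n ∈ Finset.Icc (1 : ℤ) N, G n = ∑ n' ∈ range N, G ((n' : ℤ) + 1) := by
  rw [Int.Icc_eq_finset_map, Finset.sum_map]
  have : ((N : ℤ) + 1 - 1).toNat = N := by simp
  rw [this]
  refine Finset.sum_congr rfl fun n _ => ?_
  simp [add_comm]

/-- The triple reindexing of the main term (both signs of `q`). [folklore] -/
theorem sum_qhn_reindex {M : Type*} [AddCommMonoid M] (F : ℤ → ℤ → ℤ → M) (Q H₁ N : ℕ) :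
    ∑ q ∈ (Finset.Ioo (-(Q : ℤ)) Q).erase 0, ∑ h ∈ Finset.Ico (H₁ : ℤ) (2 * H₁), ∑ n ∈ Finset.Icc (1 : ℤ) N, F q h n =
      ∑ q' ∈ range (Q - 1), ∑ h' ∈ range H₁, ∑ n' ∈ range N,
          F ((q' : ℤ) + 1) ((H₁ : ℤ) + h') ((n' : ℤ) + 1) +
      ∑ q' ∈ range (Q - 1), ∑ h' ∈ range H₁, ∑ n' ∈ range N,
          F (-((q' : ℤ) + 1)) ((H₁ : ℤ) + h') ((n' : ℤ) + 1) := by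
  rw [sum_erase_zero_eq]
  congr 1 <;> refine Finset.sum_congr rfl fun q' _ => ?_ <;> rw [sum_Ico_dyadic_eq] <;>
    refine Finset.sum_congr rfl fun h' _ => ?_ <;> rw [sum_Icc_one_eq]

/-! ### Step 2: the terms with `r = 0` (second derivative test) -/

/-- **Step 2 of [RS], `r = 0`, `q ≠ 0`**: for `H₁ ≤ h` (`h ≥ 1`) and `0 < |q|`, the sum over the
`m`-range of `e(Δ_h f(m+q) - Δ_h f(m))` is `≤ 12(C₀ L (2h|q|λ)^{1/2} + (2h|q|λ)^{-1/2})` by van der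
Corput's second derivative test (`VdC.secondDerivTest`), the second derivative being `≍ 2h|q|λ`.
[cite: RobertSargos2002, Step 2] -/
theorem qterm_bound {D : ℕ → ℝ → ℝ} {lam Λ : ℝ} {L : ℕ} (hD : DerivFamily D 0 L 4)
    (hb4 : ∀ t ∈ Set.Icc (0 : ℝ) L, lam ≤ D 4 t ∧ D 4 t ≤ Λ) (hlam : 0 < lam) (hΛ : lam ≤ Λ)
    {q h : ℤ} (hq : q ≠ 0) (hh : 1 ≤ h) :
    ‖∑ m ∈ Finset.Ioc (max h (h - q)) (min ((L : ℤ) - h) (L - h - q)),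
        e (D 0 ((m : ℝ) + q + h) - D 0 ((m : ℝ) + q - h) - (D 0 ((m : ℝ) + h) - D 0 ((m : ℝ) - h)))‖ ≤
      12 * (Λ / lam * L * Real.sqrt (2 * h * |(q : ℝ)| * lam) + 1 / Real.sqrt (2 * h * |(q : ℝ)| * lam)) := by
  set lo : ℤ := max h (h - q) with hlo
  set hi : ℤ := min ((L : ℤ) - h) (L - h - q) with hhi
  have hC₀ : 1 ≤ Λ / lam := by rwa [le_div_iff₀ hlam, one_mul]
  have hh0 : (0 : ℝ) < h := by exact_mod_cast (by omega : (0 : ℤ) < h)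
  have hqabs : (0 : ℝ) < |(q : ℝ)| := by
    rw [abs_pos]; exact_mod_cast hq
  set μ : ℝ := 2 * h * |(q : ℝ)| * lam with hμ
  have hμ0 : 0 < μ := by positivity
  have hRHS0 : 0 ≤ 12 * (Λ / lam * L * Real.sqrt μ + 1 / Real.sqrt μ) := by positivity
  -- empty range
  rcases lt_or_ge hi lo with hempty | hlohi
  · rw [Finset.Ioc_eq_empty (by omega), Finset.sum_empty, norm_zero]; exact hRHS0
  have hlen : ((hi : ℝ) - lo) ≤ L := by
    have : hi - lo ≤ (L : ℤ) := by omega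
    exact_mod_cast this
  -- the phase family
  obtain ⟨F, hF⟩ : ∃ F : ℕ → ℝ → ℝ, ∀ j x, F j x =
      D j (x + ((q : ℝ) + h)) - D j (x + ((q : ℝ) - h)) - (D j (x + h) - D j (x + -(h : ℝ))) :=
    ⟨_, fun _ _ => rfl⟩
  have hFeq : F = fun j x => D j (x + ((q : ℝ) + h)) - D j (x + ((q : ℝ) - h)) - (D j (x + h) - D j (x + -(h : ℝ))) :=
    funext fun j => funext fun x => hF j x
  have hsum : ∀ m : ℤ, e (D 0 ((m : ℝ) + q + h) - D 0 ((m : ℝ) + q - h) - (D 0 ((m : ℝ) + h) - D 0 ((m : ℝ) - h)))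
      = e (F 0 m) := by
    intro m; rw [hF]; congr 1; ring_nf
  rw [Finset.sum_congr rfl fun m _ => hsum m]
  rcases lt_or_gt_of_ne hq with hqneg | hqpos
  · -- `q < 0`: `lo = h - q`, `hi = L - h`; `-F'' ∈ [μ, C₀ μ]`
    have hlo' : lo = h - q := by omega
    have hhi' : hi = (L : ℤ) - h := by omega
    have hqr : (q : ℝ) < 0 := by exact_mod_cast hqneg
    have clo : ((lo : ℤ) : ℝ) = h - q := by rw [hlo']; push_cast; ring
    have chi : ((hi : ℤ) : ℝ) = L - h := by rw [hhi']; push_cast; ring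
    have hFam : DerivFamily (fun j x => -F j x) lo hi 4 := by
      have := derivFamily_comb4 hD ((q : ℝ) + h) ((q : ℝ) - h) (h : ℝ) (-(h : ℝ)) (lo := lo) (hi := hi)
        (by rw [clo]; linarith) (by rw [chi]; linarith) (by rw [clo]; linarith) (by rw [chi]; linarith)
        (by rw [clo]; linarith) (by rw [chi]; linarith) (by rw [clo]; linarith) (by rw [chi]; linarith)
      have hF' : DerivFamily F lo hi 4 := by rw [hFeq]; exact this
      exact derivFamily_neg hF'
    have hbound : ∀ y ∈ Set.Icc (lo : ℝ) hi, μ ≤ -F 2 y ∧ -F 2 y ≤ Λ / lam * μ := by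
      intro y hy
      rw [hlo', hhi'] at hy; push_cast at hy
      have hq' : (0 : ℝ) ≤ -(q : ℝ) := by linarith
      have key := qdiff_D2_bounds hD hb4 (q := -(q : ℝ)) (h := h) (x := y + q) hq' hh0.le
        (by linarith [hy.1]) (by linarith [hy.2])
      have e1 : -F 2 y = D 2 (y + q + (-(q : ℝ) + h)) - D 2 (y + q + (-(q : ℝ) - h)) -
          (D 2 (y + q + h) - D 2 (y + q + -(h : ℝ))) := by
        rw [hF]; ring_nf
      rw [e1]
      have habs : |(q : ℝ)| = -q := abs_of_neg (by exact_mod_cast hqneg)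
      have e2 : Λ / lam * μ = 2 * -(q : ℝ) * h * Λ := by rw [hμ, habs]; field_simp
      have e3 : μ = 2 * -(q : ℝ) * h * lam := by rw [hμ, habs]; ring
      rw [e2, e3]; exact key
    have := secondDerivTest (f := fun x => -F 0 x) (f' := fun x => -F 1 x) (f'' := fun x => -F 2 x)
      (by exact_mod_cast hlohi) hμ0 hC₀ (fun y hy => hFam 0 (by norm_num) y hy) (fun y hy => hFam 1 (by norm_num) y hy) hbound
    rw [norm_sum_e_neg (fun n => F 0 n)] at this
    refine this.trans (mul_le_mul_of_nonneg_left (add_le_add ?_ le_rfl) (by norm_num))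
    exact mul_le_mul_of_nonneg_right (mul_le_mul_of_nonneg_left hlen (by positivity)) (Real.sqrt_nonneg _)
  · -- `q > 0`: `lo = h`, `hi = L - h - q`; `F'' ∈ [μ, C₀ μ]`
    have hlo' : lo = h := by omega
    have hhi' : hi = (L : ℤ) - h - q := by omega
    have hqr : (0 : ℝ) < q := by exact_mod_cast hqpos
    have clo : ((lo : ℤ) : ℝ) = h := by rw [hlo']
    have chi : ((hi : ℤ) : ℝ) = L - h - q := by rw [hhi']; push_cast; ring
    have hFam : DerivFamily F lo hi 4 := by
      have := derivFamily_comb4 hD ((q : ℝ) + h) ((q : ℝ) - h) (h : ℝ) (-(h : ℝ)) (lo := lo) (hi := hi)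
        (by rw [clo]; linarith) (by rw [chi]; linarith) (by rw [clo]; linarith) (by rw [chi]; linarith)
        (by rw [clo]; linarith) (by rw [chi]; linarith) (by rw [clo]; linarith) (by rw [chi]; linarith)
      rw [hFeq]; exact this
    have hbound : ∀ y ∈ Set.Icc (lo : ℝ) hi, μ ≤ F 2 y ∧ F 2 y ≤ Λ / lam * μ := by
      intro y hy
      rw [hlo', hhi'] at hy; push_cast at hy
      have hq' : (0 : ℝ) ≤ (q : ℝ) := hqr.le
      have key := qdiff_D2_bounds hD hb4 (q := (q : ℝ)) (h := h) (x := y) hq' hh0.le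
        (by linarith [hy.1]) (by linarith [hy.2])
      rw [hF]
      have habs : |(q : ℝ)| = q := abs_of_pos (by exact_mod_cast hqpos)
      have e2 : Λ / lam * μ = 2 * (q : ℝ) * h * Λ := by rw [hμ, habs]; field_simp
      have e3 : μ = 2 * (q : ℝ) * h * lam := by rw [hμ, habs]; ring
      rw [e2, e3]; exact key
    have := secondDerivTest (f := F 0) (f' := F 1) (f'' := F 2)
      (by exact_mod_cast hlohi) hμ0 hC₀ (fun y hy => hFam 0 (by norm_num) y hy) (fun y hy => hFam 1 (by norm_num) y hy) hbound
    refine this.trans (mul_le_mul_of_nonneg_left (add_le_add ?_ le_rfl) (by norm_num))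
    exact mul_le_mul_of_nonneg_right (mul_le_mul_of_nonneg_left hlen (by positivity)) (Real.sqrt_nonneg _)

/-! ### Step 2: the terms with `q = 0` (third derivative test) -/

/-- **Step 2 of [RS], `q = 0`, `r ≠ 0`**: for `|r| ≤ h` and `0 < |r|`, the sum over the `m`-range of
`e(Δ_h f(m) - Δ_{h+r} f(m))` is `≤ 96 C₀ (L (2|r|λ)^{1/6} + L^{1/2} (2|r|λ)^{-1/6})` by the third
derivative test (`RobertSargos.thirdDerivTest_signed`): the third derivative is
`-(f'''(x+h+r) - f'''(x+h)) - (f'''(x-h) - f'''(x-h-r))`, of size `2|r|λ` and of constant sign (the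
printed proof obtains the same bound from Lemma 3 with `g = -2r f'`). [cite: RobertSargos2002, Step 2] -/
theorem rterm_bound {D : ℕ → ℝ → ℝ} {lam Λ : ℝ} {L : ℕ} (hD : DerivFamily D 0 L 4)
    (hb4 : ∀ t ∈ Set.Icc (0 : ℝ) L, lam ≤ D 4 t ∧ D 4 t ≤ Λ) (hlam : 0 < lam) (hΛ : lam ≤ Λ)
    {r h : ℤ} (hr : r ≠ 0) (hrh : |r| ≤ h) :
    ‖∑ m ∈ Finset.Ioc (max h (h + r)) (min ((L : ℤ) - h) (L - h - r)),
        e (D 0 ((m : ℝ) + h) - D 0 ((m : ℝ) - h) - (D 0 ((m : ℝ) + h + r) - D 0 ((m : ℝ) - h - r)))‖ ≤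
      96 * (Λ / lam) * (L * (2 * |(r : ℝ)| * lam) ^ (1 / 6 : ℝ) +
        (L : ℝ) ^ (1 / 2 : ℝ) * (2 * |(r : ℝ)| * lam) ^ (-(1 / 6 : ℝ))) := by
  set lo : ℤ := max h (h + r) with hlo
  set hi : ℤ := min ((L : ℤ) - h) (L - h - r) with hhi
  have hC₀ : 1 ≤ Λ / lam := by rwa [le_div_iff₀ hlam, one_mul]
  have hrabs : (0 : ℝ) < |(r : ℝ)| := by rw [abs_pos]; exact_mod_cast hr
  have hh0' : 0 ≤ h := le_trans (abs_nonneg r) hrh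
  have hrh1 : r ≤ h := le_trans (le_abs_self r) hrh
  have hrh2 : -r ≤ h := le_trans (neg_le_abs r) hrh
  set μ : ℝ := 2 * |(r : ℝ)| * lam with hμ
  have hμ0 : 0 < μ := by positivity
  have hRHS0 : 0 ≤ 96 * (Λ / lam) * (L * μ ^ (1 / 6 : ℝ) + (L : ℝ) ^ (1 / 2 : ℝ) * μ ^ (-(1 / 6 : ℝ))) := by
    positivity
  -- empty range
  rcases le_or_gt hi lo with hempty | hlohi
  · rw [Finset.Ioc_eq_empty (by omega), Finset.sum_empty, norm_zero]; exact hRHS0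
  have hlen : ((hi : ℝ) - lo) ≤ L := by
    have : hi - lo ≤ (L : ℤ) := by omega
    exact_mod_cast this
  have hlen0 : (0 : ℝ) ≤ (hi : ℝ) - lo := by
    have : (0 : ℤ) ≤ hi - lo := by omega
    have : ((0 : ℤ) : ℝ) ≤ ((hi - lo : ℤ) : ℝ) := by exact_mod_cast this
    simpa using this
  -- the phase family
  obtain ⟨F, hF⟩ : ∃ F : ℕ → ℝ → ℝ, ∀ j x, F j x =
      D j (x + h) - D j (x + -(h : ℝ)) - (D j (x + ((h : ℝ) + r)) - D j (x + (-(h : ℝ) - r))) :=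
    ⟨_, fun _ _ => rfl⟩
  have hFeq : F = fun j x => D j (x + h) - D j (x + -(h : ℝ)) - (D j (x + ((h : ℝ) + r)) - D j (x + (-(h : ℝ) - r))) :=
    funext fun j => funext fun x => hF j x
  have hsum : ∀ m : ℤ, e (D 0 ((m : ℝ) + h) - D 0 ((m : ℝ) - h) - (D 0 ((m : ℝ) + h + r) - D 0 ((m : ℝ) - h - r)))
      = e (F 0 m) := by
    intro m; rw [hF]; congr 1; ring_nf
  rw [Finset.sum_congr rfl fun m _ => hsum m]
  have hfinal : ∀ {G : ℕ → ℝ → ℝ}, DerivFamily G lo hi 3 →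
      ((∀ y ∈ Set.Icc (lo : ℝ) hi, μ ≤ G 3 y ∧ G 3 y ≤ Λ / lam * μ) ∨
        (∀ y ∈ Set.Icc (lo : ℝ) hi, μ ≤ -G 3 y ∧ -G 3 y ≤ Λ / lam * μ)) →
      ‖∑ n ∈ Finset.Ioc lo hi, e (G 0 n)‖ ≤
        96 * (Λ / lam) * (L * μ ^ (1 / 6 : ℝ) + (L : ℝ) ^ (1 / 2 : ℝ) * μ ^ (-(1 / 6 : ℝ))) := by
    intro G hG hbd
    have := thirdDerivTest_signed hC₀ hμ0 hlohi hG hbd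
    refine this.trans (mul_le_mul_of_nonneg_left (add_le_add ?_ ?_) (by positivity))
    · exact mul_le_mul_of_nonneg_right hlen (by positivity)
    · exact mul_le_mul_of_nonneg_right (Real.rpow_le_rpow hlen0 hlen (by norm_num)) (by positivity)
  have hFam : DerivFamily F lo hi 4 := by
    have hlo1 : h ≤ lo := le_max_left _ _
    have hlo2 : h + r ≤ lo := le_max_right _ _
    have hhi1 : hi ≤ (L : ℤ) - h := min_le_left _ _
    have hhi2 : hi ≤ (L : ℤ) - h - r := min_le_right _ _
    have c1 : ((h : ℤ) : ℝ) ≤ lo := by exact_mod_cast hlo1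
    have c2 : ((h + r : ℤ) : ℝ) ≤ lo := by exact_mod_cast hlo2
    have c3 : (hi : ℝ) ≤ (((L : ℤ) - h : ℤ) : ℝ) := by exact_mod_cast hhi1
    have c4 : (hi : ℝ) ≤ (((L : ℤ) - h - r : ℤ) : ℝ) := by exact_mod_cast hhi2
    push_cast at c2 c3 c4
    have hrle : |(r : ℝ)| ≤ h := by
      have : ((|r| : ℤ) : ℝ) ≤ h := by exact_mod_cast hrh
      simpa using this
    have hr1 := (abs_le.mp (le_refl |(r : ℝ)|)).1
    have hr2 := (abs_le.mp (le_refl |(r : ℝ)|)).2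
    have := derivFamily_comb4 hD (h : ℝ) (-(h : ℝ)) ((h : ℝ) + r) (-(h : ℝ) - r) (lo := lo) (hi := hi)
      (by linarith) (by linarith) (by linarith) (by linarith) (by linarith) (by linarith) (by linarith) (by linarith)
    rw [hFeq]; exact this
  have hFam3 : DerivFamily F lo hi 3 := fun j hj y hy => hFam j (by omega) y hy
  rcases lt_or_gt_of_ne hr with hrneg | hrpos
  · -- `r < 0`: `F''' ∈ [μ, C₀μ]`
    have hlo' : lo = h := by omega
    have hhi' : hi = (L : ℤ) - h := by omega
    refine hfinal hFam3 (Or.inl ?_)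
    intro y hy
    rw [hlo', hhi'] at hy; push_cast at hy
    have hrr : (r : ℝ) < 0 := by exact_mod_cast hrneg
    have hr' : (r : ℝ) ≤ 0 := hrr.le
    have hrle : -(r : ℝ) ≤ h := by
      have : ((|r| : ℤ) : ℝ) ≤ h := by exact_mod_cast hrh
      rw [Int.cast_abs, abs_of_nonpos hr'] at this; exact this
    have key := rdiff_D3_bounds_neg hD hb4 (r := (r : ℝ)) (h := h) (x := y) hr'
      (by linarith [hy.1]) (by linarith [hy.2]) (by linarith [hy.1]) (by linarith [hy.2])
    rw [hF]
    have habs : |(r : ℝ)| = -r := abs_of_nonpos hr'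
    have e2 : Λ / lam * μ = 2 * -(r : ℝ) * Λ := by rw [hμ, habs]; field_simp
    have e3 : μ = 2 * -(r : ℝ) * lam := by rw [hμ, habs]
    rw [e2, e3]; exact key
  · -- `r > 0`: `-F''' ∈ [μ, C₀μ]`
    have hlo' : lo = h + r := by omega
    have hhi' : hi = (L : ℤ) - h - r := by omega
    refine hfinal hFam3 (Or.inr ?_)
    intro y hy
    rw [hlo', hhi'] at hy; push_cast at hy
    have hrr : (0 : ℝ) < r := by exact_mod_cast hrpos
    have hr' : (0 : ℝ) ≤ (r : ℝ) := hrr.le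
    have hrle : (r : ℝ) ≤ h := by
      have : ((|r| : ℤ) : ℝ) ≤ h := by exact_mod_cast hrh
      rw [Int.cast_abs, abs_of_nonneg hr'] at this; exact this
    have key := rdiff_D3_bounds_pos hD hb4 (r := (r : ℝ)) (h := h) (x := y) hr'
      (by linarith [hy.1]) (by linarith [hy.2]) (by linarith [hy.1]) (by linarith [hy.2])
    rw [hF]
    have habs : |(r : ℝ)| = r := abs_of_nonneg hr'
    have e2 : Λ / lam * μ = 2 * (r : ℝ) * Λ := by rw [hμ, habs]; field_simp
    have e3 : μ = 2 * (r : ℝ) * lam := by rw [hμ, habs]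
    rw [e2, e3]; exact key

/-! ### Step 1: symmetric Weyl differencing, dyadic blocks, small `H₁` -/

/-- `ℕ`-indexed and `ℤ`-indexed dyadic block sums agree. [folklore] -/
theorem block_sum_nat_int {M : Type*} [AddCommMonoid M] (T : ℤ → M) (H₁ : ℕ) :
    ∑ d ∈ Finset.Ico H₁ (2 * H₁), T (d : ℤ) = ∑ h ∈ Finset.Ico (H₁ : ℤ) (2 * H₁), T h := by
  rw [Finset.sum_Ico_eq_sum_range, sum_Ico_dyadic_eq, show 2 * H₁ - H₁ = H₁ by omega]
  refine Finset.sum_congr rfl fun k _ => ?_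
  push_cast; rfl

/-- **Step 1 of [RS]** on `[0, L]`: the symmetric Weyl–van der Corput inequality
(`RobertSargos.vanDerCorput_symmetric_e`, (4·3)) followed by the dyadic pigeon-hole
(`RobertSargos.exists_dyadic_block`, replacing (4·4)): for `2 ≤ H ≤ L` there is a dyadic `H₁ < H` with
`|∑_{0<n≤L} e(f(n))|² ≤ 3L²/H + (6L/H)(log₂ H + 1) S(H₁)`,
`S(H₁) = ∑_{H₁ ≤ h < 2H₁} |∑_{h < m ≤ L-h} e(f(m+h) - f(m-h))|` ((4·5)–(4·6)).
[cite: RobertSargos2002, Step 1, (4.3)–(4.6)] -/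
theorem step1 (f : ℝ → ℝ) {L H : ℕ} (hH : 2 ≤ H) (hHL : H ≤ L) :
    ∃ H₁ : ℕ, 1 ≤ H₁ ∧ H₁ < H ∧
    ‖∑ n ∈ Finset.Ioc (0 : ℤ) L, e (f n)‖ ^ 2 ≤ 3 * (L : ℝ) ^ 2 / H +
      6 * (L : ℝ) / H * (((Nat.log 2 (H - 1) : ℝ) + 1) *
        ∑ h ∈ Finset.Ico (H₁ : ℤ) (2 * H₁),
          ‖∑ n ∈ Finset.Ioc h ((L : ℤ) - h), e (f ((n : ℝ) + h) - f ((n : ℝ) - h))‖) := by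
  have hH1 : 1 ≤ H := by omega
  have key := vanDerCorput_symmetric_e f (a := 0) (b := L) hH1 (by omega)
  set g : ℕ → ℝ := fun d => ‖∑ n ∈ Finset.Ioc (d : ℤ) ((L : ℤ) - d), e (f ((n : ℝ) + d) - f ((n : ℝ) - d))‖
    with hg
  have hg0 : ∀ d, 0 ≤ g d := fun d => norm_nonneg _
  have hsum : ∑ d ∈ Finset.Ico 1 H, ‖∑ n ∈ Finset.Ioc ((0 : ℤ) + d) ((L : ℤ) - d),
      e (f ((n + d : ℤ)) - f ((n - d : ℤ)))‖ = ∑ d ∈ Finset.Icc 1 (H - 1), g d := by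
    have hI : Finset.Ico 1 H = Finset.Icc 1 (H - 1) := by
      ext d; simp only [Finset.mem_Ico, Finset.mem_Icc]; omega
    rw [hI]
    refine Finset.sum_congr rfl fun d _ => ?_
    rw [hg, zero_add]
    push_cast
    rfl
  obtain ⟨H₁, H₂, hH₁, hH₁₂, hH₂K, hH₂, hblk⟩ := exists_dyadic_block (g := g) (K := H - 1) (by omega)
  refine ⟨H₁, hH₁, by omega, ?_⟩
  have hmono : ∑ d ∈ Finset.Icc H₁ H₂, g d ≤ ∑ d ∈ Finset.Ico H₁ (2 * H₁), g d := by
    apply Finset.sum_le_sum_of_subset_of_nonneg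
    · intro d hd; rw [Finset.mem_Icc] at hd; rw [Finset.mem_Ico]; omega
    · intro d _ _; exact hg0 d
  have hlog0 : (0 : ℝ) ≤ (Nat.log 2 (H - 1) : ℝ) + 1 := by positivity
  have hL0 : (0 : ℝ) ≤ 6 * (L : ℝ) / H := by positivity
  have hblk' : ∑ d ∈ Finset.Icc 1 (H - 1), g d ≤ ((Nat.log 2 (H - 1) : ℝ) + 1) *
      ∑ h ∈ Finset.Ico (H₁ : ℤ) (2 * H₁), ‖∑ n ∈ Finset.Ioc h ((L : ℤ) - h), e (f ((n : ℝ) + h) - f ((n : ℝ) - h))‖ := by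
    rw [← block_sum_nat_int (fun h => ‖∑ n ∈ Finset.Ioc h ((L : ℤ) - h), e (f ((n : ℝ) + h) - f ((n : ℝ) - h))‖) H₁]
    exact hblk.trans (mul_le_mul_of_nonneg_left hmono hlog0)
  calc ‖∑ n ∈ Finset.Ioc (0 : ℤ) L, e (f n)‖ ^ 2
      ≤ 3 * (((L : ℤ) : ℝ) - ((0 : ℤ) : ℝ)) ^ 2 / H + 6 * (((L : ℤ) : ℝ) - ((0 : ℤ) : ℝ)) / H *
          ∑ d ∈ Finset.Ico 1 H, ‖∑ n ∈ Finset.Ioc ((0 : ℤ) + d) ((L : ℤ) - d),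
            e (f ((n + d : ℤ)) - f ((n - d : ℤ)))‖ := key
    _ = 3 * (L : ℝ) ^ 2 / H + 6 * (L : ℝ) / H * ∑ d ∈ Finset.Icc 1 (H - 1), g d := by
        rw [hsum]; push_cast; ring
    _ ≤ _ := by
        refine add_le_add le_rfl (mul_le_mul_of_nonneg_left hblk' hL0)

/-- **Step 1 of [RS], small `H₁`**: by the third derivative test (`(Δ_h f)''' = f'''(x+h) - f'''(x-h)
≍ hλ`), `S(H₁) ≤ H₁ · 96 C₀ (L (4H₁λ)^{1/6} + L^{1/2} (2H₁λ)^{-1/6})` (the printed proof invokes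
Lemma 3 here). [cite: RobertSargos2002, Step 1, (4.7)] -/
theorem small_block_bound {D : ℕ → ℝ → ℝ} {lam Λ : ℝ} {L : ℕ} (hD : DerivFamily D 0 L 4)
    (hb4 : ∀ t ∈ Set.Icc (0 : ℝ) L, lam ≤ D 4 t ∧ D 4 t ≤ Λ) (hlam : 0 < lam) (hΛ : lam ≤ Λ)
    {H₁ : ℕ} (hH : 1 ≤ H₁) :
    ∑ h ∈ Finset.Ico (H₁ : ℤ) (2 * H₁),
        ‖∑ n ∈ Finset.Ioc h ((L : ℤ) - h), e (D 0 ((n : ℝ) + h) - D 0 ((n : ℝ) - h))‖ ≤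
      (H₁ : ℝ) * (96 * (Λ / lam) * (L * (4 * H₁ * lam) ^ (1 / 6 : ℝ) +
        (L : ℝ) ^ (1 / 2 : ℝ) * (2 * H₁ * lam) ^ (-(1 / 6 : ℝ)))) := by
  have hC₀ : 1 ≤ Λ / lam := by rwa [le_div_iff₀ hlam, one_mul]
  have hH0 : (0 : ℝ) < H₁ := by exact_mod_cast hH
  have hterm : ∀ h ∈ Finset.Ico (H₁ : ℤ) (2 * H₁),
      ‖∑ n ∈ Finset.Ioc h ((L : ℤ) - h), e (D 0 ((n : ℝ) + h) - D 0 ((n : ℝ) - h))‖ ≤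
        96 * (Λ / lam) * (L * (4 * H₁ * lam) ^ (1 / 6 : ℝ) +
          (L : ℝ) ^ (1 / 2 : ℝ) * (2 * H₁ * lam) ^ (-(1 / 6 : ℝ))) := by
    intro h hh
    rw [Finset.mem_Ico] at hh
    have hh0 : (0 : ℝ) < h := by exact_mod_cast (by omega : (0 : ℤ) < h)
    have hhH : (H₁ : ℝ) ≤ h := by exact_mod_cast hh.1
    have hh2 : (h : ℝ) ≤ 2 * H₁ := by
      have : (h : ℝ) < ((2 * H₁ : ℤ) : ℝ) := by exact_mod_cast hh.2
      push_cast at this; linarith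
    set μ : ℝ := 2 * h * lam with hμ
    have hμ0 : 0 < μ := by positivity
    have hRHS0 : 0 ≤ 96 * (Λ / lam) * (L * (4 * H₁ * lam) ^ (1 / 6 : ℝ) +
        (L : ℝ) ^ (1 / 2 : ℝ) * (2 * H₁ * lam) ^ (-(1 / 6 : ℝ))) := by positivity
    rcases le_or_gt ((L : ℤ) - h) h with hempty | hlt
    · rw [Finset.Ioc_eq_empty (by omega), Finset.sum_empty, norm_zero]; exact hRHS0
    -- the family `Δ_h f`
    obtain ⟨F, hF⟩ : ∃ F : ℕ → ℝ → ℝ, ∀ j x, F j x = D j (x + h) - D j (x + -(h : ℝ)) := ⟨_, fun _ _ => rfl⟩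
    have hFeq : F = fun j x => D j (x + h) - D j (x + -(h : ℝ)) := funext fun j => funext fun x => hF j x
    have hFam : DerivFamily F h ((L : ℤ) - h : ℤ) 3 := by
      have := derivFamily_comb2 hD (h : ℝ) (-(h : ℝ)) (lo := (h : ℝ)) (hi := (((L : ℤ) - h : ℤ) : ℝ))
        (by linarith) (by push_cast; linarith) (by linarith) (by push_cast; linarith)
      rw [hFeq]
      exact fun j hj x hx => this j (by omega) x hx
    have hbd : ∀ y ∈ Set.Icc (h : ℝ) (((L : ℤ) - h : ℤ) : ℝ), μ ≤ F 3 y ∧ F 3 y ≤ Λ / lam * μ := by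
      intro y hy
      push_cast at hy
      have := symm_D3_bounds hD hb4 (d := (h : ℝ)) (x := y) hh0.le (by linarith [hy.1]) (by linarith [hy.2])
      rw [hF]
      have e1 : Λ / lam * μ = 2 * h * Λ := by rw [hμ]; field_simp
      rw [e1, hμ]; exact this
    have hsum : ∀ n : ℤ, e (D 0 ((n : ℝ) + h) - D 0 ((n : ℝ) - h)) = e (F 0 n) := by
      intro n; rw [hF]; ring_nf
    rw [Finset.sum_congr rfl fun n _ => hsum n]
    have key := thirdDerivTest_signed hC₀ hμ0 hlt hFam (Or.inl hbd)
    refine key.trans ?_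
    have hlen : (((L : ℤ) - h : ℤ) : ℝ) - h ≤ L := by push_cast; linarith
    have hlen0 : (0 : ℝ) ≤ (((L : ℤ) - h : ℤ) : ℝ) - h := by
      have : ((h : ℤ) : ℝ) < (((L : ℤ) - h : ℤ) : ℝ) := by exact_mod_cast hlt
      linarith
    have hμ1 : μ ^ (1 / 6 : ℝ) ≤ (4 * H₁ * lam) ^ (1 / 6 : ℝ) :=
      Real.rpow_le_rpow hμ0.le (by rw [hμ]; nlinarith) (by norm_num)
    have hμ2 : μ ^ (-(1 / 6 : ℝ)) ≤ (2 * H₁ * lam) ^ (-(1 / 6 : ℝ)) :=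
      Real.rpow_le_rpow_of_nonpos (by positivity) (by rw [hμ]; nlinarith) (by norm_num)
    refine mul_le_mul_of_nonneg_left (add_le_add ?_ ?_) (by positivity)
    · exact mul_le_mul hlen hμ1 (by positivity) (by positivity)
    · exact mul_le_mul (Real.rpow_le_rpow hlen0 hlen (by norm_num)) hμ2 (by positivity) (by positivity)
  calc _ ≤ ∑ h ∈ Finset.Ico (H₁ : ℤ) (2 * H₁), 96 * (Λ / lam) * (L * (4 * H₁ * lam) ^ (1 / 6 : ℝ) +
          (L : ℝ) ^ (1 / 2 : ℝ) * (2 * H₁ * lam) ^ (-(1 / 6 : ℝ))) := Finset.sum_le_sum hterm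
    _ = _ := by
        rw [Finset.sum_const, nsmul_eq_mul, Int.card_Ico]
        have : (2 * (H₁ : ℤ) - H₁).toNat = H₁ := by rw [show 2 * (H₁ : ℤ) - H₁ = H₁ by ring]; simp
        rw [this]

/-! ### Steps 2–3: the `A × A` process and the shift -/

set_option maxHeartbeats 2000000 in
/-- **Steps 2 and 3 of [RS]** for the dyadic piece `S(H₁) = ∑_{H₁ ≤ h < 2H₁} |∑_{h<m≤L-h} e(Δ_h f(m))|`
(`Δ_h f(x) = f(x+h) - f(x-h)`, `f = D 0` on `[0, L]`, `λ ≤ f⁗ ≤ Λ`): by Lemma 1 (`RobertSargos.aProcess_AA`,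
with unimodular weights `c_h` turning `|a_h|` into `c_h a_h`) and the estimates of Step 2 for the terms
with `r = 0` or `q = 0` (`qterm_bound`, `rterm_bound`), followed by the shift of Step 3
(`shift_avg_approx`, window `J₀ = (Y₀, L - Y₀ - N]`, `Y₀ = Q + N + 3H₁ + R + 7`):
`S(H₁)² ≤ (4LH₁/(QR)) [LH₁ + ∑_{q≠0,h} (2nd-derivative bounds) + ∑_{r≠0} (H₁ (3rd-derivative bound)
  + 2QH₁(2Y₀+N) + (1/N) ∑_{m ∈ J₀} |∑_{q≠0} ∑_h ∑_{n=1}^{N} (1-|q|/Q) θ_r(h) e(Δ_h f(m+n+q) - Δ_{h+r} f(m+n))|)]`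
with `|θ_r(h)| ≤ 1` — the inequality (4·12) with the degenerate terms kept explicit.
[cite: RobertSargos2002, Steps 2–3, (4.9)–(4.12)] -/
theorem step23 {D : ℕ → ℝ → ℝ} {lam Λ : ℝ} {L : ℕ} (hD : DerivFamily D 0 L 4)
    (hb4 : ∀ t ∈ Set.Icc (0 : ℝ) L, lam ≤ D 4 t ∧ D 4 t ≤ Λ) (hlam : 0 < lam) (hΛ : lam ≤ Λ)
    {H₁ Q R N : ℕ} (hH : 1 ≤ H₁) (hQ : 1 ≤ Q) (hQL : Q ≤ L) (hR : 1 ≤ R) (hRH : R ≤ H₁) (hN : 1 ≤ N) :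
    ∃ θ : ℤ → ℤ → ℂ, (∀ r h, ‖θ r h‖ ≤ 1) ∧
    (∑ h ∈ Finset.Ico (H₁ : ℤ) (2 * H₁),
        ‖∑ n ∈ Finset.Ioc h ((L : ℤ) - h), e (D 0 ((n : ℝ) + h) - D 0 ((n : ℝ) - h))‖) ^ 2 ≤
      4 * (L : ℝ) * H₁ / (Q * R) *
        ((L : ℝ) * H₁ +
          ∑ q ∈ (Finset.Ioo (-(Q : ℤ)) Q).erase 0, ∑ h ∈ Finset.Ico (H₁ : ℤ) (2 * H₁),
            12 * (Λ / lam * L * Real.sqrt (2 * h * |(q : ℝ)| * lam) + 1 / Real.sqrt (2 * h * |(q : ℝ)| * lam)) +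
          ∑ r ∈ (Finset.Ioo (-(R : ℤ)) R).erase 0,
            ((H₁ : ℝ) * (96 * (Λ / lam) * (L * (2 * |(r : ℝ)| * lam) ^ (1 / 6 : ℝ) +
                  (L : ℝ) ^ (1 / 2 : ℝ) * (2 * |(r : ℝ)| * lam) ^ (-(1 / 6 : ℝ)))) +
              2 * (Q : ℝ) * H₁ * (2 * ((Q : ℝ) + N + 3 * H₁ + R + 7) + N) +
              1 / (N : ℝ) * ∑ m ∈ Finset.Ioc ((Q : ℤ) + N + 3 * H₁ + R + 7) ((L : ℤ) - ((Q : ℤ) + N + 3 * H₁ + R + 7) - N),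
                ‖∑ q ∈ (Finset.Ioo (-(Q : ℤ)) Q).erase 0, ∑ h ∈ Finset.Ico (H₁ : ℤ) (2 * H₁),
                    ∑ n ∈ Finset.Icc (1 : ℤ) N,
                  (((1 - |(q : ℝ)| / Q : ℝ)) : ℂ) * θ r h *
                    e (D 0 ((m : ℝ) + n + q + h) - D 0 ((m : ℝ) + n + q - h) -
                      (D 0 ((m : ℝ) + n + h + r) - D 0 ((m : ℝ) + n - h - r)))‖)) := by
  classical
  -- the sums `a_h` and unimodular coefficients `c_h` with `c_h a_h = |a_h|`
  obtain ⟨aH, haH⟩ : ∃ aH : ℤ → ℂ, ∀ h, aH h =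
      ∑ n ∈ Finset.Ioc h ((L : ℤ) - h), e (D 0 ((n : ℝ) + h) - D 0 ((n : ℝ) - h)) := ⟨_, fun _ => rfl⟩
  obtain ⟨c, hc1, hc2⟩ := exists_unit_coeffs aH
  obtain ⟨θ, hθ⟩ : ∃ θ : ℤ → ℤ → ℂ, ∀ r h, θ r h =
      if (H₁ : ℤ) ≤ h + r ∧ h + r < 2 * H₁ then c h * conj (c (h + r)) else 0 := ⟨_, fun _ _ => rfl⟩
  have hcc : ∀ h r, ‖c h * conj (c (h + r))‖ ≤ 1 := by
    intro h r
    rw [norm_mul, Complex.norm_conj]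
    calc ‖c h‖ * ‖c (h + r)‖ ≤ 1 * 1 := mul_le_mul (hc1 _) (hc1 _) (norm_nonneg _) zero_le_one
      _ = 1 := one_mul _
  have hθ1 : ∀ r h, ‖θ r h‖ ≤ 1 := by
    intro r h; rw [hθ]; split_ifs
    · exact hcc h r
    · simp
  refine ⟨θ, hθ1, ?_⟩
  -- the phases `φ_{q,h,r}(x) = Δ_h f(x+q) - Δ_{h+r} f(x)`
  obtain ⟨φ, hφ⟩ : ∃ φ : ℤ → ℤ → ℤ → ℝ → ℝ, ∀ q h r x, φ q h r x =
      D 0 (x + q + h) - D 0 (x + q - h) - (D 0 (x + h + r) - D 0 (x - h - r)) := ⟨_, fun _ _ _ _ => rfl⟩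
  -- the function `A(m, h) = c_h e(Δ_h f(m)) 1[H₁ ≤ h < 2H₁, h < m ≤ L - h]` and its shift `a'`
  obtain ⟨A, hA⟩ : ∃ A : ℤ → ℤ → ℂ, ∀ m h, A m h =
      if (H₁ : ℤ) ≤ h ∧ h < 2 * H₁ ∧ h < m ∧ m ≤ (L : ℤ) - h then
        c h * e (D 0 ((m : ℝ) + h) - D 0 ((m : ℝ) - h)) else 0 := ⟨_, fun _ _ => rfl⟩
  have hA1 : ∀ m h, ‖A m h‖ ≤ 1 := by
    intro m h; rw [hA]; split_ifs
    · rw [norm_mul, norm_e, mul_one]; exact hc1 h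
    · simp
  obtain ⟨a', ha'⟩ : ∃ a' : ℤ → ℤ → ℂ, ∀ m h', a' m h' = A m (h' + ((H₁ : ℤ) - 1)) := ⟨_, fun _ _ => rfl⟩
  have hsupp : ∀ m h', a' m h' ≠ 0 → m ∈ Finset.Ioc (0 : ℤ) L ∧ h' ∈ Finset.Ioc (0 : ℤ) H₁ := by
    intro m h' hne
    rw [ha', hA] at hne
    by_cases hc : (H₁ : ℤ) ≤ h' + ((H₁ : ℤ) - 1) ∧ h' + ((H₁ : ℤ) - 1) < 2 * H₁ ∧
        h' + ((H₁ : ℤ) - 1) < m ∧ m ≤ (L : ℤ) - (h' + ((H₁ : ℤ) - 1))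
    · rw [Finset.mem_Ioc, Finset.mem_Ioc]; omega
    · rw [if_neg hc] at hne; exact absurd rfl hne
  have hAA := aProcess_AA a' L H₁ hsupp hQ hQL hR hRH
  -- reindexing `h' ↦ h = h' + H₁ - 1`
  have hIco : Finset.Ioc ((0 : ℤ) + ((H₁ : ℤ) - 1)) ((H₁ : ℤ) + ((H₁ : ℤ) - 1)) = Finset.Ico (H₁ : ℤ) (2 * H₁) := by
    ext m; simp only [Finset.mem_Ioc, Finset.mem_Ico]; omega
  have hreidx : ∀ G : ℤ → ℂ, ∑ h' ∈ Finset.Ioc (0 : ℤ) H₁, G (h' + ((H₁ : ℤ) - 1)) =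
      ∑ h ∈ Finset.Ico (H₁ : ℤ) (2 * H₁), G h := by
    intro G; rw [sum_Ioc_shift G 0 H₁ ((H₁ : ℤ) - 1), hIco]
  -- the left-hand side of Lemma 1 is `S(H₁)`
  have hfilt0 : ∀ h ∈ Finset.Ico (H₁ : ℤ) (2 * H₁),
      (Finset.Ioc (0 : ℤ) L).filter (fun m => (H₁ : ℤ) ≤ h ∧ h < 2 * H₁ ∧ h < m ∧ m ≤ (L : ℤ) - h) =
        Finset.Ioc h ((L : ℤ) - h) := by
    intro h hh; rw [Finset.mem_Ico] at hh
    ext m; simp only [Finset.mem_filter, Finset.mem_Ioc]; omega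
  have hcol : ∀ h ∈ Finset.Ico (H₁ : ℤ) (2 * H₁), ∑ m ∈ Finset.Ioc (0 : ℤ) L, A m h = (‖aH h‖ : ℂ) := by
    intro h hh
    rw [Finset.sum_congr rfl fun m _ => hA m h, ← Finset.sum_filter, hfilt0 h hh, ← Finset.mul_sum,
      ← haH, hc2]
  have hLHS : ∑ m ∈ Finset.Ioc (0 : ℤ) L, ∑ h' ∈ Finset.Ioc (0 : ℤ) H₁, a' m h' =
      ((∑ h ∈ Finset.Ico (H₁ : ℤ) (2 * H₁), ‖aH h‖ : ℝ) : ℂ) := by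
    rw [Finset.sum_comm]
    simp only [ha']
    rw [show (∑ h' ∈ Finset.Ioc (0 : ℤ) H₁, ∑ m ∈ Finset.Ioc (0 : ℤ) L, A m (h' + ((H₁ : ℤ) - 1))) =
        ∑ h ∈ Finset.Ico (H₁ : ℤ) (2 * H₁), ∑ m ∈ Finset.Ioc (0 : ℤ) L, A m h from
      hreidx (fun h => ∑ m ∈ Finset.Ioc (0 : ℤ) L, A m h), Complex.ofReal_sum]
    exact Finset.sum_congr rfl hcol
  have hS0 : 0 ≤ ∑ h ∈ Finset.Ico (H₁ : ℤ) (2 * H₁), ‖aH h‖ := Finset.sum_nonneg fun _ _ => norm_nonneg _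
  have hnormLHS : ‖∑ m ∈ Finset.Ioc (0 : ℤ) L, ∑ h' ∈ Finset.Ioc (0 : ℤ) H₁, a' m h'‖ =
      ∑ h ∈ Finset.Ico (H₁ : ℤ) (2 * H₁), ‖aH h‖ := by
    rw [hLHS, Complex.norm_real, Real.norm_eq_abs, abs_of_nonneg hS0]
  rw [Finset.sum_congr rfl fun h _ => show ‖∑ n ∈ Finset.Ioc h ((L : ℤ) - h),
      e (D 0 ((n : ℝ) + h) - D 0 ((n : ℝ) - h))‖ = ‖aH h‖ by rw [haH], ← hnormLHS]
  refine hAA.trans (mul_le_mul_of_nonneg_left ?_ (by positivity))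
  -- the correlations `G(q, r, h) = ∑_m A(m+q, h) conj A(m, h+r)`
  obtain ⟨G, hG⟩ : ∃ G : ℤ → ℤ → ℤ → ℂ, ∀ q r h, G q r h =
      ∑ m ∈ Finset.Ioc (0 : ℤ) L, A (m + q) h * conj (A m (h + r)) := ⟨_, fun _ _ _ => rfl⟩
  have hCorr : ∀ q r, ∑ m ∈ Finset.Ioc (0 : ℤ) L, ∑ h' ∈ Finset.Ioc (0 : ℤ) H₁,
      a' (m + q) h' * conj (a' m (h' + r)) = ∑ h ∈ Finset.Ico (H₁ : ℤ) (2 * H₁), G q r h := by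
    intro q r
    rw [Finset.sum_comm]
    simp only [ha', hG]
    have e1 : ∀ h' m : ℤ, A m (h' + r + ((H₁ : ℤ) - 1)) = A m (h' + ((H₁ : ℤ) - 1) + r) := by
      intro h' m; congr 1; ring
    simp only [e1]
    exact hreidx (fun h => ∑ m ∈ Finset.Ioc (0 : ℤ) L, A (m + q) h * conj (A m (h + r)))
  -- the summands of `G`
  have hprod : ∀ q r h m, A (m + q) h * conj (A m (h + r)) =
      if (((H₁ : ℤ) ≤ h ∧ h < 2 * H₁ ∧ h < m + q ∧ m + q ≤ (L : ℤ) - h) ∧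
          ((H₁ : ℤ) ≤ h + r ∧ h + r < 2 * H₁ ∧ h + r < m ∧ m ≤ (L : ℤ) - (h + r)))
      then c h * conj (c (h + r)) * e (φ q h r m) else 0 := by
    intro q r h m
    rw [hA (m + q) h, hA m (h + r)]
    by_cases h1 : ((H₁ : ℤ) ≤ h ∧ h < 2 * H₁ ∧ h < m + q ∧ m + q ≤ (L : ℤ) - h)
    · by_cases h2 : ((H₁ : ℤ) ≤ h + r ∧ h + r < 2 * H₁ ∧ h + r < m ∧ m ≤ (L : ℤ) - (h + r))
      · rw [if_pos h1, if_pos h2, if_pos ⟨h1, h2⟩, map_mul]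
        have : φ q h r m = (D 0 (((m + q : ℤ) : ℝ) + h) - D 0 (((m + q : ℤ) : ℝ) - h)) -
            (D 0 ((m : ℝ) + ((h + r : ℤ) : ℝ)) - D 0 ((m : ℝ) - ((h + r : ℤ) : ℝ))) := by
          rw [hφ]; push_cast; ring_nf
        rw [this, e_sub (D 0 (((m + q : ℤ) : ℝ) + h) - D 0 (((m + q : ℤ) : ℝ) - h))
          (D 0 ((m : ℝ) + ((h + r : ℤ) : ℝ)) - D 0 ((m : ℝ) - ((h + r : ℤ) : ℝ)))]
        ring
      · rw [if_pos h1, if_neg h2, if_neg (fun H => h2 H.2), map_zero, mul_zero]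
    · rw [if_neg h1, zero_mul, if_neg (fun H => h1 H.1)]
  have hGsum : ∀ q r h, G q r h = c h * conj (c (h + r)) *
      ∑ m ∈ (Finset.Ioc (0 : ℤ) L).filter (fun m =>
        (((H₁ : ℤ) ≤ h ∧ h < 2 * H₁ ∧ h < m + q ∧ m + q ≤ (L : ℤ) - h) ∧
          ((H₁ : ℤ) ≤ h + r ∧ h + r < 2 * H₁ ∧ h + r < m ∧ m ≤ (L : ℤ) - (h + r)))), e (φ q h r m) := by
    intro q r h
    rw [hG, Finset.sum_congr rfl fun m _ => hprod q r h m, ← Finset.sum_filter, Finset.mul_sum]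
  -- `G` in terms of `θ` and an interval
  have hGθ : ∀ q r, ∀ h ∈ Finset.Ico (H₁ : ℤ) (2 * H₁), -(R : ℤ) < r → r < R → -(Q : ℤ) < q → q < Q →
      G q r h = θ r h * ∑ m ∈ Finset.Ioc (max (h - q) (h + r)) (min ((L : ℤ) - h - q) ((L : ℤ) - h - r)),
        e (φ q h r m) := by
    intro q r h hh hr1 hr2 hq1 hq2
    rw [Finset.mem_Ico] at hh
    rw [hGsum, hθ]
    by_cases hd : (H₁ : ℤ) ≤ h + r ∧ h + r < 2 * H₁
    · rw [if_pos hd]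
      congr 1
      apply Finset.sum_congr _ (fun _ _ => rfl)
      ext m; simp only [Finset.mem_filter, Finset.mem_Ioc]; omega
    · rw [if_neg hd, zero_mul, Finset.sum_eq_zero (fun m hm => ?_), mul_zero]
      rw [Finset.mem_filter] at hm
      exact absurd ⟨hm.2.2.1, hm.2.2.2.1⟩ hd
  have hGnorm : ∀ q r, ∀ h ∈ Finset.Ico (H₁ : ℤ) (2 * H₁), -(R : ℤ) < r → r < R → -(Q : ℤ) < q → q < Q →
      ‖G q r h‖ ≤ ‖∑ m ∈ Finset.Ioc (max (h - q) (h + r)) (min ((L : ℤ) - h - q) ((L : ℤ) - h - r)),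
        e (φ q h r m)‖ := by
    intro q r h hh hr1 hr2 hq1 hq2
    rw [hGθ q r h hh hr1 hr2 hq1 hq2, norm_mul]
    calc _ ≤ 1 * _ := mul_le_mul_of_nonneg_right (hθ1 r h) (norm_nonneg _)
      _ = _ := one_mul _
  -- weights
  have hw : ∀ q : ℤ, -(Q : ℤ) < q → q < Q → 0 ≤ 1 - |(q : ℝ)| / Q ∧ 1 - |(q : ℝ)| / Q ≤ 1 := by
    intro q hq1 hq2
    have hQ0 : (0 : ℝ) < Q := by exact_mod_cast hQ
    have habs : |(q : ℝ)| ≤ Q := by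
      rw [abs_le]; constructor
      · have : ((-(Q : ℤ) : ℤ) : ℝ) < q := by exact_mod_cast hq1
        push_cast at this; linarith
      · have : (q : ℝ) < ((Q : ℤ) : ℝ) := by exact_mod_cast hq2
        push_cast at this; linarith
    constructor
    · rw [sub_nonneg, div_le_one hQ0]; exact habs
    · have : 0 ≤ |(q : ℝ)| / Q := by positivity
      linarith
  have hwR : ∀ r : ℤ, -(R : ℤ) < r → r < R → 0 ≤ 1 - |(r : ℝ)| / R ∧ 1 - |(r : ℝ)| / R ≤ 1 := by
    intro r hr1 hr2
    have hR0 : (0 : ℝ) < R := by exact_mod_cast hR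
    have habs : |(r : ℝ)| ≤ R := by
      rw [abs_le]; constructor
      · have : ((-(R : ℤ) : ℤ) : ℝ) < r := by exact_mod_cast hr1
        push_cast at this; linarith
      · have : (r : ℝ) < ((R : ℤ) : ℝ) := by exact_mod_cast hr2
        push_cast at this; linarith
    constructor
    · rw [sub_nonneg, div_le_one hR0]; exact habs
    · have : 0 ≤ |(r : ℝ)| / R := by positivity
      linarith
  -- notation for the ranges
  set QQ := Finset.Ioo (-(Q : ℤ)) Q with hQQ
  set RR := Finset.Ioo (-(R : ℤ)) R with hRR
  set HH := Finset.Ico (H₁ : ℤ) (2 * H₁) with hHH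
  have h0Q : (0 : ℤ) ∈ QQ := by rw [hQQ, Finset.mem_Ioo]; omega
  have h0R : (0 : ℤ) ∈ RR := by rw [hRR, Finset.mem_Ioo]; omega
  have hmemQ : ∀ q ∈ QQ, -(Q : ℤ) < q ∧ q < Q := fun q hq => by rwa [hQQ, Finset.mem_Ioo] at hq
  have hmemR : ∀ r ∈ RR, -(R : ℤ) < r ∧ r < R := fun r hr => by rwa [hRR, Finset.mem_Ioo] at hr
  have hmemQ' : ∀ q ∈ QQ.erase 0, q ≠ 0 ∧ -(Q : ℤ) < q ∧ q < Q := fun q hq => by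
    rw [Finset.mem_erase] at hq; exact ⟨hq.1, hmemQ q hq.2⟩
  have hmemR' : ∀ r ∈ RR.erase 0, r ≠ 0 ∧ -(R : ℤ) < r ∧ r < R := fun r hr => by
    rw [Finset.mem_erase] at hr; exact ⟨hr.1, hmemR r hr.2⟩
  have hmemH : ∀ h ∈ HH, (H₁ : ℤ) ≤ h ∧ h < 2 * H₁ := fun h hh => by rwa [hHH, Finset.mem_Ico] at hh
  have hcardH : (HH.card : ℝ) = H₁ := by
    rw [hHH, Int.card_Ico]
    have : (2 * (H₁ : ℤ) - H₁).toNat = H₁ := by rw [show 2 * (H₁ : ℤ) - H₁ = H₁ by ring]; simp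
    rw [this]
  have hcardQ' : ((QQ.erase 0).card : ℝ) ≤ 2 * Q := by
    rw [Finset.card_erase_of_mem h0Q, hQQ, Int.card_Ioo]
    have : ((Q : ℤ) - -(Q : ℤ) - 1).toNat - 1 ≤ 2 * Q := by omega
    exact_mod_cast this
  -- Step (1): rewrite the correlations and swap the sums
  simp only [hCorr]
  rw [Finset.sum_comm]
  -- Step (2): `‖∑_r ∑_q w_q w_r X(q,r)‖ ≤ ∑_r ‖∑_q w_q X(q,r)‖`
  have hfac : ∀ r ∈ RR, ‖∑ q ∈ QQ, ((((1 - |(q : ℝ)| / Q) * (1 - |(r : ℝ)| / R)) : ℝ) : ℂ) * ∑ h ∈ HH, G q r h‖ ≤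
      ‖∑ q ∈ QQ, (((1 - |(q : ℝ)| / Q) : ℝ) : ℂ) * ∑ h ∈ HH, G q r h‖ := by
    intro r hr
    obtain ⟨hr1, hr2⟩ := hmemR r hr
    have e1 : ∑ q ∈ QQ, ((((1 - |(q : ℝ)| / Q) * (1 - |(r : ℝ)| / R)) : ℝ) : ℂ) * ∑ h ∈ HH, G q r h =
        (((1 - |(r : ℝ)| / R) : ℝ) : ℂ) * ∑ q ∈ QQ, (((1 - |(q : ℝ)| / Q) : ℝ) : ℂ) * ∑ h ∈ HH, G q r h := by
      rw [Finset.mul_sum]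
      refine Finset.sum_congr rfl fun q _ => ?_
      push_cast; ring
    rw [e1, norm_mul, Complex.norm_real, Real.norm_eq_abs, abs_of_nonneg (hwR r hr1 hr2).1]
    calc _ ≤ 1 * _ := mul_le_mul_of_nonneg_right (hwR r hr1 hr2).2 (norm_nonneg _)
      _ = _ := one_mul _
  refine (norm_sum_le _ _).trans ?_
  refine (Finset.sum_le_sum hfac).trans ?_
  rw [← Finset.add_sum_erase RR _ h0R]
  -- Step (3): the term `r = 0`
  have hr0 : ‖∑ q ∈ QQ, (((1 - |(q : ℝ)| / Q) : ℝ) : ℂ) * ∑ h ∈ HH, G q 0 h‖ ≤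
      (L : ℝ) * H₁ + ∑ q ∈ QQ.erase 0, ∑ h ∈ HH,
        12 * (Λ / lam * L * Real.sqrt (2 * h * |(q : ℝ)| * lam) + 1 / Real.sqrt (2 * h * |(q : ℝ)| * lam)) := by
    have s1 : ‖∑ q ∈ QQ, (((1 - |(q : ℝ)| / Q) : ℝ) : ℂ) * ∑ h ∈ HH, G q 0 h‖ ≤ ∑ q ∈ QQ, ∑ h ∈ HH, ‖G q 0 h‖ := by
      refine (norm_sum_le _ _).trans (Finset.sum_le_sum fun q hq => ?_)
      obtain ⟨hq1, hq2⟩ := hmemQ q hq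
      rw [norm_mul, Complex.norm_real, Real.norm_eq_abs, abs_of_nonneg (hw q hq1 hq2).1]
      calc _ ≤ 1 * ‖∑ h ∈ HH, G q 0 h‖ := mul_le_mul_of_nonneg_right (hw q hq1 hq2).2 (norm_nonneg _)
        _ = ‖∑ h ∈ HH, G q 0 h‖ := one_mul _
        _ ≤ _ := norm_sum_le _ _
    refine s1.trans ?_
    rw [← Finset.add_sum_erase QQ _ h0Q]
    refine add_le_add ?_ (Finset.sum_le_sum fun q hq => Finset.sum_le_sum fun h hh => ?_)
    · -- `q = 0 = r`: at most `L H₁` terms of modulus `≤ 1`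
      have hterm : ∀ h ∈ HH, ‖G 0 0 h‖ ≤ L := by
        intro h _
        rw [hG]
        refine (norm_sum_le _ _).trans ?_
        have : ∀ m ∈ Finset.Ioc (0 : ℤ) L, ‖A (m + 0) h * conj (A m (h + 0))‖ ≤ 1 := by
          intro m _
          rw [norm_mul, Complex.norm_conj]
          calc _ ≤ (1 : ℝ) * 1 := mul_le_mul (hA1 _ _) (hA1 _ _) (norm_nonneg _) zero_le_one
            _ = 1 := one_mul _
        refine (Finset.sum_le_sum this).trans ?_
        rw [Finset.sum_const, Int.card_Ioc, nsmul_eq_mul, mul_one]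
        simp
      calc ∑ h ∈ HH, ‖G 0 0 h‖ ≤ ∑ h ∈ HH, (L : ℝ) := Finset.sum_le_sum hterm
        _ = (L : ℝ) * H₁ := by rw [Finset.sum_const, nsmul_eq_mul, hcardH, mul_comm]
    · -- `r = 0`, `q ≠ 0`: second derivative test
      obtain ⟨hq0, hq1, hq2⟩ := hmemQ' q hq
      obtain ⟨hh1, hh2⟩ := hmemH h hh
      refine (hGnorm q 0 h hh (by omega) (by omega) hq1 hq2).trans ?_
      have e1 : Finset.Ioc (max (h - q) (h + 0)) (min ((L : ℤ) - h - q) ((L : ℤ) - h - 0)) =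
          Finset.Ioc (max h (h - q)) (min ((L : ℤ) - h) ((L : ℤ) - h - q)) := by
        rw [add_zero, sub_zero, max_comm, min_comm]
      have e2 : ∀ m : ℤ, e (φ q h 0 m) =
          e (D 0 ((m : ℝ) + q + h) - D 0 ((m : ℝ) + q - h) - (D 0 ((m : ℝ) + h) - D 0 ((m : ℝ) - h))) := by
        intro m; rw [hφ]; simp
      rw [e1, Finset.sum_congr rfl fun m _ => e2 m]
      exact qterm_bound hD hb4 hlam hΛ hq0 (by omega)
  refine add_le_add hr0 (Finset.sum_le_sum fun r hr => ?_)
  -- Step (4): `r ≠ 0`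
  obtain ⟨hr0', hr1, hr2⟩ := hmemR' r hr
  rw [← Finset.add_sum_erase QQ _ h0Q]
  refine (norm_add_le _ _).trans ?_
  rw [add_assoc]
  refine add_le_add ?_ ?_
  · -- `q = 0`, `r ≠ 0`: third derivative test
    have e0 : (((1 - |((0 : ℤ) : ℝ)| / Q) : ℝ) : ℂ) = 1 := by simp
    rw [e0, one_mul]
    have hterm : ∀ h ∈ HH, ‖G 0 r h‖ ≤ 96 * (Λ / lam) * (L * (2 * |(r : ℝ)| * lam) ^ (1 / 6 : ℝ) +
        (L : ℝ) ^ (1 / 2 : ℝ) * (2 * |(r : ℝ)| * lam) ^ (-(1 / 6 : ℝ))) := by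
      intro h hh
      obtain ⟨hh1, hh2⟩ := hmemH h hh
      refine (hGnorm 0 r h hh hr1 hr2 (by omega) (by omega)).trans ?_
      have e1 : Finset.Ioc (max (h - 0) (h + r)) (min ((L : ℤ) - h - 0) ((L : ℤ) - h - r)) =
          Finset.Ioc (max h (h + r)) (min ((L : ℤ) - h) ((L : ℤ) - h - r)) := by
        rw [sub_zero, sub_zero]
      have e2 : ∀ m : ℤ, e (φ 0 h r m) =
          e (D 0 ((m : ℝ) + h) - D 0 ((m : ℝ) - h) - (D 0 ((m : ℝ) + h + r) - D 0 ((m : ℝ) - h - r))) := by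
        intro m; rw [hφ]; simp
      rw [e1, Finset.sum_congr rfl fun m _ => e2 m]
      exact rterm_bound hD hb4 hlam hΛ hr0' (by rw [abs_le]; omega)
    calc ‖∑ h ∈ HH, G 0 r h‖ ≤ ∑ h ∈ HH, ‖G 0 r h‖ := norm_sum_le _ _
      _ ≤ ∑ h ∈ HH, 96 * (Λ / lam) * (L * (2 * |(r : ℝ)| * lam) ^ (1 / 6 : ℝ) +
          (L : ℝ) ^ (1 / 2 : ℝ) * (2 * |(r : ℝ)| * lam) ^ (-(1 / 6 : ℝ))) := Finset.sum_le_sum hterm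
      _ = (H₁ : ℝ) * (96 * (Λ / lam) * (L * (2 * |(r : ℝ)| * lam) ^ (1 / 6 : ℝ) +
          (L : ℝ) ^ (1 / 2 : ℝ) * (2 * |(r : ℝ)| * lam) ^ (-(1 / 6 : ℝ)))) := by
          rw [Finset.sum_const, nsmul_eq_mul, hcardH]
  · -- `q ≠ 0`, `r ≠ 0`: the shift of Step 3
    set Y₀ : ℤ := (Q : ℤ) + N + 3 * H₁ + R + 7 with hY₀
    set J₀ := Finset.Ioc Y₀ ((L : ℤ) - Y₀ - N) with hJ₀
    set E : ℝ := 2 * ((Q : ℝ) + N + 3 * H₁ + R + 7) + N with hE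
    -- the main term, per `(q, h)`
    have happrox : ∀ q ∈ QQ.erase 0, ∀ h ∈ HH,
        ‖(((1 - |(q : ℝ)| / Q) : ℝ) : ℂ) * G q r h -
          (((1 - |(q : ℝ)| / Q) : ℝ) : ℂ) * θ r h * ((1 / (N : ℂ)) * ∑ n ∈ Finset.Icc (1 : ℤ) N,
            ∑ m ∈ J₀, e (φ q h r (m + n)))‖ ≤ E := by
      intro q hq h hh
      obtain ⟨hq0, hq1, hq2⟩ := hmemQ' q hq
      obtain ⟨hh1, hh2⟩ := hmemH h hh
      rw [hGθ q r h hh hr1 hr2 hq1 hq2, ← mul_assoc, ← mul_sub, norm_mul, norm_mul, Complex.norm_real,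
        Real.norm_eq_abs, abs_of_nonneg (hw q hq1 hq2).1]
      have key := shift_avg_approx (fun m => e (φ q h r m)) (fun m => (norm_e _).le) hN
        (lo := max (h - q) (h + r)) (hi := min ((L : ℤ) - h - q) ((L : ℤ) - h - r)) (c₀ := Y₀)
        (d₀ := (L : ℤ) - Y₀ - N) (by omega) (by omega) (E := E) ?_
      · simp only [Int.cast_add] at key
        calc _ ≤ 1 * 1 * E := by
              refine mul_le_mul (mul_le_mul (hw q hq1 hq2).2 (hθ1 r h) (norm_nonneg _) zero_le_one) ?_
                (norm_nonneg _) (by norm_num)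
              exact key
          _ = E := by ring
      · have : (min ((L : ℤ) - h - q) ((L : ℤ) - h - r) - max (h - q) (h + r)).toNat ≤
            ((L : ℤ) - Y₀ - N - Y₀).toNat + (2 * (Q + N + 3 * H₁ + R + 7) + N) := by omega
        have : ((min ((L : ℤ) - h - q) ((L : ℤ) - h - r) - max (h - q) (h + r)).toNat : ℝ) ≤
            ((((L : ℤ) - Y₀ - N - Y₀).toNat + (2 * (Q + N + 3 * H₁ + R + 7) + N) : ℕ) : ℝ) := by
          exact_mod_cast this
        refine this.trans (le_of_eq ?_)
        rw [hE]; push_cast; ring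
    -- rearranging the main term
    set W : ℤ → ℂ := fun q => (((1 - |(q : ℝ)| / Q) : ℝ) : ℂ) with hW
    set NN := Finset.Icc (1 : ℤ) N with hNN
    have hM : (1 / (N : ℂ)) * ∑ m ∈ J₀, ∑ q ∈ QQ.erase 0, ∑ h ∈ HH, ∑ n ∈ NN,
          W q * θ r h * e (φ q h r (m + n)) =
        ∑ q ∈ QQ.erase 0, ∑ h ∈ HH, W q * θ r h *
          ((1 / (N : ℂ)) * ∑ n ∈ NN, ∑ m ∈ J₀, e (φ q h r (m + n))) := by
      rw [Finset.sum_comm (s := J₀) (t := QQ.erase 0), Finset.mul_sum]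
      refine Finset.sum_congr rfl fun q _ => ?_
      rw [Finset.sum_comm (s := J₀) (t := HH), Finset.mul_sum]
      refine Finset.sum_congr rfl fun h _ => ?_
      simp only [Finset.mul_sum]
      rw [Finset.sum_comm (s := J₀) (t := NN)]
      refine Finset.sum_congr rfl fun n _ => Finset.sum_congr rfl fun m _ => ?_
      ring
    have hdecomp : ∑ q ∈ QQ.erase 0, W q * ∑ h ∈ HH, G q r h =
        ∑ q ∈ QQ.erase 0, ∑ h ∈ HH, (W q * G q r h -
          W q * θ r h * ((1 / (N : ℂ)) * ∑ n ∈ NN, ∑ m ∈ J₀, e (φ q h r (m + n)))) +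
        (1 / (N : ℂ)) * ∑ m ∈ J₀, ∑ q ∈ QQ.erase 0, ∑ h ∈ HH, ∑ n ∈ NN,
          W q * θ r h * e (φ q h r (m + n)) := by
      rw [hM, ← Finset.sum_add_distrib]
      refine Finset.sum_congr rfl fun q _ => ?_
      rw [Finset.mul_sum, ← Finset.sum_add_distrib]
      refine Finset.sum_congr rfl fun h _ => ?_
      ring
    have hE0 : 0 ≤ E := by rw [hE]; positivity
    rw [hdecomp]
    refine (norm_add_le _ _).trans (add_le_add ?_ ?_)
    · -- the errors of the shift
      calc ‖∑ q ∈ QQ.erase 0, ∑ h ∈ HH, (W q * G q r h -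
              W q * θ r h * ((1 / (N : ℂ)) * ∑ n ∈ NN, ∑ m ∈ J₀, e (φ q h r (m + n))))‖
          ≤ ∑ q ∈ QQ.erase 0, ∑ h ∈ HH, E := by
            refine (norm_sum_le _ _).trans (Finset.sum_le_sum fun q hq =>
              (norm_sum_le _ _).trans (Finset.sum_le_sum fun h hh => ?_))
            exact happrox q hq h hh
        _ = ((QQ.erase 0).card : ℝ) * ((H₁ : ℝ) * E) := by
            rw [Finset.sum_const, Finset.sum_const, nsmul_eq_mul, nsmul_eq_mul, hcardH]
        _ ≤ 2 * Q * ((H₁ : ℝ) * E) := mul_le_mul_of_nonneg_right hcardQ' (by positivity)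
        _ = 2 * (Q : ℝ) * H₁ * E := by ring
    · -- the main term
      rw [norm_mul, show ‖(1 / (N : ℂ))‖ = 1 / (N : ℝ) by simp]
      refine mul_le_mul_of_nonneg_left ((norm_sum_le _ _).trans (le_of_eq ?_)) (by positivity)
      refine Finset.sum_congr rfl fun m _ => ?_
      congr 1
      refine Finset.sum_congr rfl fun q _ => Finset.sum_congr rfl fun h _ =>
        Finset.sum_congr rfl fun n _ => ?_
      simp only [hW, hφ]

end Thm1

end RobertSargos
end Literature.NumberTheory.LFunctions

end
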